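import Literature.Geometry.Symplectic.SelfDualTripleRotation
import Literature.Geometry.Symplectic.AdaptedFrameFamily
import Literature.Geometry.Symplectic.NearSymplecticZeroCircles
import Literature.Analysis.Matrix.SignatureTwoOneOfMinority
import HarnessLib

/-!
# Perutz's matrix `S` in an adapted frame

Topic `Geometry/Symplectic`; namespace `Literature.Geometry.Symplectic`.  No `sorry`, no named
fact.  Fix a gradient `G : ℝ⁴ →L Λ²` with `G e₀ = 0` and an adapted frame `(A, c, η)` in the
sense of `NearSymplecticAdaptedFrame.exists_adaptedFrame_of_definiteImage` (`A e₀ = e₀`,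
`η_k(Au, Av) = c β_k(u, v)`, `G W = Σ_k (⟨GW, η_k⟩/2s) η_k`).  The coefficients
`S_k(W) = ⟨G(AW), η_k⟩ / 2s` (`perutzCoeff`) are linear in `W` and vanish on `e₀`, so they are
given by a `3 × 3` matrix `T` on the normal part (`perutzMatrix`, `perutzCoeff_eq_mulVec`), and

* `gradient_frame_sum` — `G(AW)(AU, AV) = c Σ_k S_k(W) β_k(U, V)`;
* `perutzForm_frame` — Perutz's form `P(v, u) = G(v)(e₀, u)` reads `P(Av', Au') = c ⟨u'_N, T v'_N⟩`;
* `perutzMatrix_isSymm` — `T` is symmetric as soon as `P` is (closedness of the form);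
* `perutzMatrix_mulVec_eq_zero` — `T` is non-degenerate (rank of `G`);
* `minority_perutzMatrix` — a minority vector `w` of `P` yields a minority vector
  `(A⁻¹ w)_N` of the matrix `c T`: the hypotheses of
  `Literature.Analysis.Matrix.exists_negative_eigenvector_of_minority`.

This is the matrix `S(t) = S⁺(t) ⊕ S⁻(t)` of Perutz 2006, §3 (proof of Lemma 3.1, step 1) before
block-diagonalisation, with its symmetry (§2.3 (c)) and the eigenline data (§2.3 (d)).

## References

* T. Perutz, *Zero-sets of near-symplectic forms*, J. Symplectic Geom. 4 (2006), §2.3 (c)–(d)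
  and §3. [Perutz2006]
-/

noncomputable section

open Set Function Module Matrix Literature.Geometry.Kaehler Literature.Topology.FourManifolds
  Literature.Analysis.Matrix
open scoped Matrix

namespace Literature.Geometry.Symplectic

variable {G : EuclideanSpace ℝ (Fin 4) →L[ℝ] ((EuclideanSpace ℝ (Fin 4)) [⋀^Fin 2]→L[ℝ] ℝ)}
  {A : EuclideanSpace ℝ (Fin 4) ≃L[ℝ] EuclideanSpace ℝ (Fin 4)} {c s : ℝ}
  {η : Fin 3 → (EuclideanSpace ℝ (Fin 4)) [⋀^Fin 2]→L[ℝ] ℝ}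

/-! ### The coefficients and their matrix -/

/-- **Perutz's coefficients in an adapted frame**: `S_k(W) = ⟨G(AW), η_k⟩ / 2s`.
[cite: Perutz2006, §3 (proof of Lemma 3.1, step 1)] -/
def perutzCoeff (G : EuclideanSpace ℝ (Fin 4) →L[ℝ] ((EuclideanSpace ℝ (Fin 4)) [⋀^Fin 2]→L[ℝ] ℝ))
    (A : EuclideanSpace ℝ (Fin 4) ≃L[ℝ] EuclideanSpace ℝ (Fin 4))
    (η : Fin 3 → (EuclideanSpace ℝ (Fin 4)) [⋀^Fin 2]→L[ℝ] ℝ) (s : ℝ)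
    (W : EuclideanSpace ℝ (Fin 4)) (k : Fin 3) : ℝ :=
  pfaffianPair (G (A W)) (η k) / (2 * s)

/-- **Perutz's matrix in an adapted frame**: `T_{ka} = S_k(e_{a+1})`, so that
`S(W) = T W_N`. [cite: Perutz2006, §3 (proof of Lemma 3.1, step 1)] -/
def perutzMatrix (G : EuclideanSpace ℝ (Fin 4) →L[ℝ] ((EuclideanSpace ℝ (Fin 4)) [⋀^Fin 2]→L[ℝ] ℝ))
    (A : EuclideanSpace ℝ (Fin 4) ≃L[ℝ] EuclideanSpace ℝ (Fin 4))
    (η : Fin 3 → (EuclideanSpace ℝ (Fin 4)) [⋀^Fin 2]→L[ℝ] ℝ) (s : ℝ) :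
    Matrix (Fin 3) (Fin 3) ℝ :=
  Matrix.of fun k a ↦ perutzCoeff G A η s (stdVec a.succ) k

/-- Unfolding the coefficients. [folklore] -/
theorem perutzCoeff_apply (W : EuclideanSpace ℝ (Fin 4)) (k : Fin 3) :
    perutzCoeff G A η s W k = pfaffianPair (G (A W)) (η k) / (2 * s) := rfl

/-- Unfolding the matrix. [folklore] -/
theorem perutzMatrix_apply (k a : Fin 3) :
    perutzMatrix G A η s k a = perutzCoeff G A η s (stdVec a.succ) k := rfl

/-- The wedge pairing of a finite combination on the left. [folklore] -/
theorem pfaffianPair_finset_sum_smul_left {ι : Type*} (t : Finset ι) (a : ι → ℝ)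
    (ζ : ι → (EuclideanSpace ℝ (Fin 4)) [⋀^Fin 2]→L[ℝ] ℝ)
    (β : (EuclideanSpace ℝ (Fin 4)) [⋀^Fin 2]→L[ℝ] ℝ) :
    pfaffianPair (∑ i ∈ t, a i • ζ i) β = ∑ i ∈ t, a i * pfaffianPair (ζ i) β := by
  classical
  induction t using Finset.induction_on with
  | empty => simp
  | insert i t hi ih =>
    rw [Finset.sum_insert hi, Finset.sum_insert hi, pfaffianPair_add_left, pfaffianPair_smul_left,
      ih]

/-- **The coefficients are linear in `W`.** [folklore] -/
theorem perutzCoeff_add (W W' : EuclideanSpace ℝ (Fin 4)) (k : Fin 3) :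
    perutzCoeff G A η s (W + W') k = perutzCoeff G A η s W k + perutzCoeff G A η s W' k := by
  simp only [perutzCoeff_apply, map_add, pfaffianPair_add_left, add_div]

/-- Homogeneity of the coefficients. [folklore] -/
theorem perutzCoeff_smul (r : ℝ) (W : EuclideanSpace ℝ (Fin 4)) (k : Fin 3) :
    perutzCoeff G A η s (r • W) k = r * perutzCoeff G A η s W k := by
  simp only [perutzCoeff_apply, map_smul, pfaffianPair_smul_left, mul_div_assoc]

/-- The coefficients vanish on the axis vector (`A e₀ = e₀`, `G e₀ = 0`). [folklore] -/
theorem perutzCoeff_stdVec_zero (hA0 : A (stdVec 0) = stdVec 0) (hG0 : G (stdVec 0) = 0)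
    (k : Fin 3) : perutzCoeff G A η s (stdVec 0) k = 0 := by
  rw [perutzCoeff_apply, hA0, hG0, pfaffianPair_zero_left, zero_div]

/-- **`S(W) = T W_N`**: the coefficients are the matrix applied to the normal part.
[cite: Perutz2006, §3 (proof of Lemma 3.1, step 1)] -/
theorem perutzCoeff_eq_mulVec (hA0 : A (stdVec 0) = stdVec 0) (hG0 : G (stdVec 0) = 0)
    (W : EuclideanSpace ℝ (Fin 4)) (k : Fin 3) :
    perutzCoeff G A η s W k = (perutzMatrix G A η s *ᵥ normalPart W) k := by
  conv_lhs => rw [eq_sum_smul_stdVec W]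
  rw [Matrix.mulVec, dotProduct]
  -- expand the coefficient of a combination
  have hlin : perutzCoeff G A η s (∑ i, W i • stdVec i) k =
      ∑ i, W i * perutzCoeff G A η s (stdVec i) k := by
    simp only [perutzCoeff_apply, map_sum, map_smul, pfaffianPair_finset_sum_smul_left,
      Finset.sum_div, mul_div_assoc]
  rw [hlin, Fin.sum_univ_succ, perutzCoeff_stdVec_zero hA0 hG0, mul_zero, zero_add]
  exact Finset.sum_congr rfl fun a _ ↦ by rw [perutzMatrix_apply, normalPart_apply, mul_comm]

/-! ### The gradient and Perutz's form in the frame -/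

/-- Values of the standard triple against the axis vector: `β_k(e₀, V) = V_{k+1}`. [folklore] -/
@[simp] theorem hondaBetaVec_stdVec_zero (V : EuclideanSpace ℝ (Fin 4)) (k : Fin 3) :
    hondaBetaVec (stdVec 0) V k = V k.succ := by
  fin_cases k <;> simp [hondaBetaVec, stdVec]

/-- **The gradient in the adapted frame, summed form**: `G(AW)(AU, AV) = c Σ_k S_k(W) β_k(U, V)`.
[cite: Perutz2006, §3 (proof of Lemma 3.1, step 1)] -/
theorem gradient_frame_sum
    (hvec : ∀ k u v, η k ![A u, A v] = c * hondaBetaVec u v k)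
    (hexp : ∀ W, G W = ∑ k, (pfaffianPair (G W) (η k) / (2 * s)) • η k)
    (W U V : EuclideanSpace ℝ (Fin 4)) :
    G (A W) ![A U, A V] = c * ∑ k, perutzCoeff G A η s W k * hondaBetaVec U V k := by
  conv_lhs => rw [hexp (A W)]
  rw [sum_smul_alt_apply, Finset.mul_sum]
  exact Finset.sum_congr rfl fun k _ ↦ by rw [hvec, perutzCoeff_apply]; ring

/-- The three frame relations packed with `hondaBetaVec`. [folklore] -/
theorem frame_relation_vec
    (h1 : ∀ u v, η 0 ![A u, A v] = c * hondaBeta₁ ![u, v])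
    (h2 : ∀ u v, η 1 ![A u, A v] = c * hondaBeta₂ ![u, v])
    (h3 : ∀ u v, η 2 ![A u, A v] = c * hondaBeta₃ ![u, v]) (k : Fin 3)
    (u v : EuclideanSpace ℝ (Fin 4)) : η k ![A u, A v] = c * hondaBetaVec u v k := by
  fin_cases k
  · simpa [hondaBetaVec] using h1 u v
  · simpa [hondaBetaVec] using h2 u v
  · simpa [hondaBetaVec] using h3 u v

/-- **Perutz's form in the adapted frame**: `G(Av')(e₀, Au') = c ⟨u'_N, T v'_N⟩`.
[cite: Perutz2006, §2.3 (c)] -/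
theorem perutzForm_frame
    (hvec : ∀ k u v, η k ![A u, A v] = c * hondaBetaVec u v k)
    (hexp : ∀ W, G W = ∑ k, (pfaffianPair (G W) (η k) / (2 * s)) • η k)
    (hA0 : A (stdVec 0) = stdVec 0) (hG0 : G (stdVec 0) = 0) (v' u' : EuclideanSpace ℝ (Fin 4)) :
    G (A v') ![stdVec 0, A u'] = c * (normalPart u' ⬝ᵥ perutzMatrix G A η s *ᵥ normalPart v') := by
  conv_lhs => rw [← hA0]
  rw [gradient_frame_sum hvec hexp, dotProduct]
  congr 1
  exact Finset.sum_congr rfl fun k _ ↦ by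
    rw [hondaBetaVec_stdVec_zero, perutzCoeff_eq_mulVec hA0 hG0, normalPart_apply, mul_comm]

/-- **Symmetry of Perutz's matrix** from the symmetry of Perutz's form `P(p, q) = G(p)(e₀, q)`
(which is the cocycle identity of the closed form at its zero). [cite: Perutz2006, §2.3 (c)] -/
theorem perutzMatrix_isSymm
    (hvec : ∀ k u v, η k ![A u, A v] = c * hondaBetaVec u v k)
    (hexp : ∀ W, G W = ∑ k, (pfaffianPair (G W) (η k) / (2 * s)) • η k)
    (hA0 : A (stdVec 0) = stdVec 0) (hG0 : G (stdVec 0) = 0) (hc : c ≠ 0)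
    (hsym : ∀ p q, G p ![stdVec 0, q] = G q ![stdVec 0, p]) :
    (perutzMatrix G A η s).IsSymm := by
  have hentry : ∀ k a, c * perutzMatrix G A η s k a =
      G (A (stdVec a.succ)) ![stdVec 0, A (stdVec k.succ)] := by
    intro k a
    rw [perutzForm_frame hvec hexp hA0 hG0]
    congr 1
    -- `⟨(e_{k+1})_N, T (e_{a+1})_N⟩ = T_{ka}`
    have hN : ∀ b : Fin 3, normalPart (stdVec b.succ : EuclideanSpace ℝ (Fin 4)) = Pi.single b 1 := by
      intro b; funext j
      fin_cases b <;> fin_cases j <;> simp [stdVec]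
    rw [hN, hN, Matrix.mulVec_single_one, dotProduct_comm, dotProduct_single_one]
    rfl
  ext k a
  have h := hsym (A (stdVec a.succ)) (A (stdVec k.succ))
  rw [← hentry k a, ← hentry a k] at h
  exact (mul_right_injective₀ hc h).symm

/-- **Non-degeneracy of Perutz's matrix**: `T v = 0 ⇒ v = 0`, because `G(A v_lift) = Σ S_k η_k`
would vanish, forcing `A v_lift ∈ ker G = ℝ e₀`. [cite: Perutz2006, §2.3 (c)] -/
theorem perutzMatrix_mulVec_eq_zero
    (hexp : ∀ W, G W = ∑ k, (pfaffianPair (G W) (η k) / (2 * s)) • η k)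
    (hA0 : A (stdVec 0) = stdVec 0) (hG0 : G (stdVec 0) = 0)
    (hker : ∀ u, G u = 0 → ∃ b : ℝ, b • stdVec 0 = u) {v : Fin 3 → ℝ}
    (hv : perutzMatrix G A η s *ᵥ v = 0) : v = 0 := by
  have hS : ∀ k, perutzCoeff G A η s (normalLift v) k = 0 := fun k ↦ by
    rw [perutzCoeff_eq_mulVec hA0 hG0, normalPart_normalLift, hv]; rfl
  have hGv : G (A (normalLift v)) = 0 := by
    rw [hexp (A (normalLift v))]
    refine Finset.sum_eq_zero fun k _ ↦ ?_
    have h := hS k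
    rw [perutzCoeff_apply] at h
    rw [h, zero_smul]
  obtain ⟨b, hb⟩ := hker _ hGv
  have hb' : normalLift v = b • stdVec 0 := by
    apply A.injective
    rw [map_smul, hA0, hb]
  have h := congrArg normalPart hb'
  rw [normalPart_normalLift] at h
  rw [h]
  funext j
  simp [stdVec, Fin.succ_ne_zero]

/-! ### Transfer of a minority vector -/

/-- **A minority vector of Perutz's form gives a minority vector of the matrix `cT`**: with
`n = (A⁻¹ w)_N`, `⟨n, cT n⟩ ≠ 0` and `⟨n, cT n⟩⟨v, cT v⟩ ≤ ⟨n, cT v⟩²` for all `v`.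
[cite: Perutz2006, §2.3 (d)] -/
theorem minority_perutzMatrix
    (hvec : ∀ k u v, η k ![A u, A v] = c * hondaBetaVec u v k)
    (hexp : ∀ W, G W = ∑ k, (pfaffianPair (G W) (η k) / (2 * s)) • η k)
    (hA0 : A (stdVec 0) = stdVec 0) (hG0 : G (stdVec 0) = 0)
    (hTsym : (perutzMatrix G A η s).IsSymm) {w : EuclideanSpace ℝ (Fin 4)}
    (hmin : IsMinorityVector (fun v u ↦ G v ![stdVec 0, u]) w) :
    normalPart (A.symm w) ⬝ᵥ (c • perutzMatrix G A η s) *ᵥ normalPart (A.symm w) ≠ 0 ∧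
      ∀ v : Fin 3 → ℝ,
        (normalPart (A.symm w) ⬝ᵥ (c • perutzMatrix G A η s) *ᵥ normalPart (A.symm w)) *
            (v ⬝ᵥ (c • perutzMatrix G A η s) *ᵥ v) ≤
          (normalPart (A.symm w) ⬝ᵥ (c • perutzMatrix G A η s) *ᵥ v) ^ 2 := by
  set T := perutzMatrix G A η s with hT
  set n := normalPart (A.symm w) with hn
  have hP := perutzForm_frame (s := s) hvec hexp hA0 hG0
  have hww : G w ![stdVec 0, w] = c * (n ⬝ᵥ T *ᵥ n) := by
    conv_lhs => rw [← A.apply_symm_apply w]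
    rw [hP]
  have hvv : ∀ v : Fin 3 → ℝ, G (A (normalLift v)) ![stdVec 0, A (normalLift v)] =
      c * (v ⬝ᵥ T *ᵥ v) := fun v ↦ by
    rw [hP, normalPart_normalLift]
  have hwv : ∀ v : Fin 3 → ℝ, G w ![stdVec 0, A (normalLift v)] = c * (n ⬝ᵥ T *ᵥ v) := fun v ↦ by
    conv_lhs => rw [← A.apply_symm_apply w]
    rw [hP, normalPart_normalLift, dotProduct_mulVec_comm_of_isSymm hTsym]
  have hscal : ∀ a b : Fin 3 → ℝ, a ⬝ᵥ (c • T) *ᵥ b = c * (a ⬝ᵥ T *ᵥ b) := fun a b ↦ by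
    rw [smul_mulVec, dotProduct_smul, smul_eq_mul]
  refine ⟨?_, fun v ↦ ?_⟩
  · rw [hscal, ← hww]; exact hmin.1
  · have h := hmin.2 (A (normalLift v))
    simp only at h
    rw [hww, hvv, hwv] at h
    rw [hscal, hscal, hscal]
    exact h

end Literature.Geometry.Symplectic

end
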